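import Summits.CriticalPhenomena.PercolationContinuityZ3.Theorems.PercNearOneGluingAdditiveGluingSandwichLemma3
import Summits.CriticalPhenomena.PercolationContinuityZ3.Theorems.PercNearOneGluingAdditiveGluingBhkSets
import Summits.CriticalPhenomena.PercolationContinuityZ3.Theorems.PercNearOneGluingAdditiveGluingKnThm2GoodAux
import HarnessLib

/-!
# Corollary H of the sandwich-BHK inequality with a conditioning SET

Crux `PercNearOneGluing.AdditiveGluing` (stmt-CriticalPhenomena-4576), line
`subuniform-dead-pocket-maximum`, stub `stub_goodStep` (TTRL deep variant V1362: the good case of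
three relays with the dead-pocket penalty); lands with `--supports stmt-CriticalPhenomena-4576`.
No new definitions, no named facts.

`sandwich_condAssocT`: Corollary H of siege seat k41 (`sandwich_condAssoc`, file `…SandwichLemma3`)
with the single separating vertex `t` replaced by a SET `T`: given `D = {s ↮ T}`, an increasing
function `F(C_s)` of the open edge cluster of `s` and the sandwich function
`g = 1{s ↔ o} + 1{s ↮ o} 1{o ↮ T} h(C_o)` (`h : Set (Sym2 V) → [0,1]` ARBITRARY) are positively
correlated, `(∫_D F)(∫_D g) ≤ μ(D) ∫_D F g`.  This is Theorem S (`SandwichK41.coreS`) with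
`U = univ`, `X = Y = T` — the proof is the `X = Y = {t}` proof verbatim.
-/

noncomputable section

open MeasureTheory unitInterval
open Literature.Probability.LatticeModels (prodBernoulli)
open Literature.Probability.Percolation
open Literature.Probability.Percolation.BHK2006

namespace Summit.CriticalPhenomena.PercolationContinuityZ3.Theorems

open scoped Classical in
open SandwichK41 DecisionTree in
/-- **Corollary H with a conditioning set.**  Let `s, o` be vertices, `T` a set of vertices,
`F` increasing and `h : Set (Sym2 V) → [0,1]` arbitrary.  Given `D = {s ↮ T}`, the cluster
function `F(C_s)` and the sandwich function `g = 1{s ↔ o} + 1{s ↮ o} 1{o ↮ T} h(C_o)` are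
positively correlated: `(∫_D F(C_s) dμ)(∫_D g dμ) ≤ μ(D) ∫_D F(C_s) g dμ`, `μ = prodBernoulli w`
(Theorem S, `SandwichK41.coreS`, with `U = univ`, `X = Y = T`, `F` shifted by `F ∅`); the sandwich
function is passed as `gg` together with its defining equation `hg`.
[cite: VandenbergHaggstromKahn2005, Thms. 1.1–1.5 (pp. 3–8)] -/
theorem sandwich_condAssocT {V : Type*} [Fintype V] (w : Sym2 V → unitInterval) (s o : V)
    (T : Set V) (F : Set (Sym2 V) → ℝ) (hF : Monotone F) (h : Set (Sym2 V) → ℝ)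
    (h0 : ∀ C, 0 ≤ h C) (h1 : ∀ C, h C ≤ 1) (gg : BondConfig V → ℝ)
    (hg : ∀ ω, gg ω = if (openGraph ω).Reachable s o then (1 : ℝ)
      else if ∃ t ∈ T, (openGraph ω).Reachable o t then 0 else h (openEdgeCluster ω o)) :
    (∫ ω in {ω : BondConfig V | ∀ t ∈ T, ¬ (openGraph ω).Reachable s t},
        F (openEdgeCluster ω s) ∂(prodBernoulli w)) *
      (∫ ω in {ω : BondConfig V | ∀ t ∈ T, ¬ (openGraph ω).Reachable s t}, gg ω ∂(prodBernoulli w)) ≤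
    (prodBernoulli w).real {ω : BondConfig V | ∀ t ∈ T, ¬ (openGraph ω).Reachable s t} *
      ∫ ω in {ω : BondConfig V | ∀ t ∈ T, ¬ (openGraph ω).Reachable s t},
        F (openEdgeCluster ω s) * gg ω ∂(prodBernoulli w) := by
  classical
  set D : Set (BondConfig V) := {ω | ∀ t ∈ T, ¬ (openGraph ω).Reachable s t} with hD
  show (∫ ω in D, F (openEdgeCluster ω s) ∂(prodBernoulli w)) * (∫ ω in D, gg ω ∂(prodBernoulli w)) ≤
    (prodBernoulli w).real D * ∫ ω in D, F (openEdgeCluster ω s) * gg ω ∂(prodBernoulli w)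
  have hDm : MeasurableSet D := MeasurableSet.of_discrete
  set w' : Sym2 V → ℝ := fun e => (w e : ℝ) with hw'
  have hw0 : ∀ e, 0 ≤ w' e := fun e => (w e).2.1
  have hw1 : ∀ e, w' e ≤ 1 := fun e => (w e).2.2
  -- the integrals as finite sums
  have hint : ∀ k : Set (Sym2 V) → ℝ,
      ∫ ω in D, k ω ∂(prodBernoulli w) = ∑ ω, weight w' ω * (k ω * ind D ω) := by
    intro k
    rw [← integral_indicator hDm, integral_prodBernoulli_eq_sum]
    refine Finset.sum_congr rfl fun ω _ => ?_
    by_cases hω : ω ∈ D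
    · rw [Set.indicator_of_mem hω, ind_of_mem hω, mul_one]
    · rw [Set.indicator_of_notMem hω, ind_of_not_mem hω]; ring
  have hreal : (prodBernoulli w).real D = ∑ ω, weight w' ω * ind D ω := by
    rw [← integral_indicator_one hDm, integral_prodBernoulli_eq_sum]
    refine Finset.sum_congr rfl fun ω _ => ?_
    by_cases hω : ω ∈ D
    · rw [Set.indicator_of_mem hω, ind_of_mem hω, Pi.one_apply]
    · rw [Set.indicator_of_notMem hω, ind_of_not_mem hω, mul_zero]
  have hm : ∑ ω, weight w' ω = 1 := by
    have e := integral_prodBernoulli_eq_sum w fun _ => (1 : ℝ)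
    simp only [integral_const, probReal_univ, smul_eq_mul, mul_one] at e
    exact e.symm
  -- `U = univ`: the restricted quantities are the original ones
  have hE : ∀ ω : Set (Sym2 V), ω ∩ edgesIn (Finset.univ : Finset V) = ω := fun ω => by
    ext e
    simp only [Set.mem_inter_iff, edgesIn, Set.mem_setOf_eq, Finset.mem_univ, imp_true_iff,
      and_true]
  have hC : ∀ (v : V) ω, rC Finset.univ v ω = openEdgeCluster ω v := fun v ω => by
    simp only [rC, hE]
  have hDD : rD Finset.univ s T = D := by
    ext ω
    simp only [rD, hE, hD, Set.mem_setOf_eq]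
  set g : V → Finset V → Set V → Set (Sym2 V) → ℝ := fun s' U T' ω =>
    if (openGraph (ω ∩ edgesIn U)).Reachable s' o then (1 : ℝ) else h (rC U o ω) * ind (rD U o T') ω
    with hgdef
  have hgt : ∀ ω, g s Finset.univ T ω = gg ω := by
    intro ω
    rw [hg ω]
    simp only [hgdef, hC, hE]
    by_cases hso : (openGraph ω).Reachable s o
    · rw [if_pos hso, if_pos hso]
    · rw [if_neg hso, if_neg hso]
      by_cases hot : ∃ t ∈ T, (openGraph ω).Reachable o t
      · rw [if_pos hot, ind_of_not_mem]
        · ring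
        · intro hω
          obtain ⟨t, ht, hot'⟩ := hot
          exact hω t ht (by simpa only [hE] using hot')
      · rw [if_neg hot, ind_of_mem, mul_one]
        intro x hx
        have hox : ¬ (openGraph ω).Reachable o x := fun h' => hot ⟨x, hx, h'⟩
        simpa only [hE] using hox
  -- Theorem S with `X = Y = T` for the shifted (nonnegative) `F`
  have hXU : T ⊆ ↑(Finset.univ : Finset V) := by simp
  have key := coreS w' hw0 hw1 hm o h h0 h1 g (fun _ _ _ _ => rfl) Finset.univ s (Finset.mem_univ s)
    (Finset.mem_univ o) T T hXU hXU (fun a => F a - F ∅)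
    (fun a b hab => sub_le_sub_right (hF hab) _) (fun a => sub_nonneg.2 (hF (Set.empty_subset a)))
  rw [Set.inter_self, Set.union_self] at key
  simp only [hC, hDD, hgt] at key
  -- expand the shifted sums
  set P := ∑ ω, weight w' ω * ind D ω with hP
  set Ef := ∑ ω, weight w' ω * (F (openEdgeCluster ω s) * ind D ω) with hEf
  set Eg := ∑ ω, weight w' ω * (gg ω * ind D ω) with hEg
  set Efg := ∑ ω, weight w' ω * (F (openEdgeCluster ω s) * gg ω * ind D ω) with hEfg
  have x1 : ∑ ω, weight w' ω * ((F (openEdgeCluster ω s) - F ∅) * ind D ω) = Ef - F ∅ * P := by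
    have := sum_affine w' (fun ω => (F (openEdgeCluster ω s) - F ∅) * ind D ω)
      (fun ω => F (openEdgeCluster ω s) * ind D ω) (ind D) (ind D) (ind D) 1 (-F ∅) 0 0
      (fun ω => by ring)
    rw [this]; ring
  have x3 : ∑ ω, weight w' ω * ((F (openEdgeCluster ω s) - F ∅) * gg ω * ind D ω) =
      Efg - F ∅ * Eg := by
    have := sum_affine w' (fun ω => (F (openEdgeCluster ω s) - F ∅) * gg ω * ind D ω)
      (fun ω => F (openEdgeCluster ω s) * gg ω * ind D ω) (fun ω => gg ω * ind D ω) (ind D) (ind D)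
      1 (-F ∅) 0 0 (fun ω => by ring)
    rw [this]; ring
  rw [x1, x3] at key
  -- conclude
  rw [hint, hint, hint (fun ω => F (openEdgeCluster ω s) * gg ω), hreal]
  show Ef * Eg ≤ P * Efg
  nlinarith [key]


/-! ### Source SETS: the hub augmentation -/

section SetSource

open Set

/-- `hubLift⟦A, η⟧`: the hub lift of a configuration (file-local notation for the tree term, as in
`…BhkSetsAux`): the old pairs of `η` through `some` plus the hub pairs `s(none, some a)`, `a ∈ A`. -/
local notation3 (prettyPrint := false) "hubLift⟦" A ", " η "⟧" =>
  (Sym2.map some '' η ∪ {e | ∃ a ∈ A, e = s(none, some a)})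

/-- `hubW⟦A, w⟧`: the augmented weights (file-local notation for the tree term, as in `…BhkSetsAux`):
`w` on the old pairs, `1` on the hub pairs `s(none, some a)`, `a ∈ A`, `0` on the other new pairs. -/
local notation3 (prettyPrint := false) "hubW⟦" A ", " w "⟧" =>
  (Function.extend (Sym2.map some) w fun e =>
    @ite unitInterval (∃ a ∈ A, e = s(none, some a)) (Classical.dec _) 1 0)

open scoped Classical in
/-- **Corollary H for the open cluster of a vertex SET `S`** (conditioning set `T`, observer `o`):
given `D = {S ↮ T}`, an increasing function `F(C_S)` of `C_S = ⋃_{s ∈ S} C_s` and the sandwich function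
`g = 1{S ↔ o} + 1{S ↮ o} 1{o ↮ T} h(C_o)` (`h : Set (Sym2 V) → [0,1]` arbitrary) are positively correlated,
`(∫_D F)(∫_D g) ≤ μ(D) ∫_D F g`.  Proof by hub augmentation (the reduction of `…BhkSetsAux`):
`sandwich_condAssocT` on `Option (Fin n)` for the hub `none` joined to `S` by weight-one pairs, the
observer `some o` and the set `some '' T`, transported along the lift of configurations; the sandwich function is passed as `g` with its
defining equation `hg`
(`bhkHub_integral`; the hub is joined to `some x` iff `S ↔ x`; off `{S ↔ o}` the observer's cluster and
its connections are those of the original configuration, `bhkHub_reachable_some_some`,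
`bhkHub_preimage_cluster_some`; the old pairs of the hub's cluster are `C_S`, `bhkHub_preimage_cluster_none`).
[cite: VandenbergHaggstromKahn2005, Thms. 1.1–1.5 (pp. 3–8) and Remark after Thm. 1.2] -/
theorem sandwich_condAssoc_setSource {n : ℕ} (w : Sym2 (Fin n) → unitInterval) (S : Finset (Fin n))
    (o : Fin n) (T : Set (Fin n)) (F : Set (Sym2 (Fin n)) → ℝ) (hF : Monotone F)
    (h : Set (Sym2 (Fin n)) → ℝ) (h0 : ∀ C, 0 ≤ h C) (h1 : ∀ C, h C ≤ 1) (g : BondConfig (Fin n) → ℝ)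
    (hg : ∀ ω, g ω = if ∃ s ∈ S, (openGraph ω).Reachable s o then (1 : ℝ)
      else if ∃ t ∈ T, (openGraph ω).Reachable o t then 0 else h (openEdgeCluster ω o)) :
    (∫ ω in {ω : BondConfig (Fin n) | ∀ s ∈ S, ∀ t ∈ T, ¬ (openGraph ω).Reachable s t},
        F (⋃ s ∈ S, openEdgeCluster ω s) ∂(prodBernoulli w)) *
      (∫ ω in {ω : BondConfig (Fin n) | ∀ s ∈ S, ∀ t ∈ T, ¬ (openGraph ω).Reachable s t},
        g ω ∂(prodBernoulli w)) ≤
    (prodBernoulli w).real {ω : BondConfig (Fin n) | ∀ s ∈ S, ∀ t ∈ T, ¬ (openGraph ω).Reachable s t} *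
      ∫ ω in {ω : BondConfig (Fin n) | ∀ s ∈ S, ∀ t ∈ T, ¬ (openGraph ω).Reachable s t},
        F (⋃ s ∈ S, openEdgeCluster ω s) * g ω ∂(prodBernoulli w) := by
  set T' : Set (Option (Fin n)) := some '' T with hT'
  set F' : Set (Sym2 (Option (Fin n))) → ℝ := fun C => F (Sym2.map some ⁻¹' C) with hF'
  set h' : Set (Sym2 (Option (Fin n))) → ℝ := fun C => h (Sym2.map some ⁻¹' C) with hh'
  have hF'm : Monotone F' := fun C C' hCC' => hF (preimage_mono hCC')
  have h0' : ∀ C, 0 ≤ h' C := fun C => h0 _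
  have h1' : ∀ C, h' C ≤ 1 := fun C => h1 _
  set g' : BondConfig (Option (Fin n)) → ℝ := fun ω' =>
    if (openGraph ω').Reachable none (some o) then (1 : ℝ)
      else if ∃ t ∈ T', (openGraph ω').Reachable (some o) t then 0
      else h' (openEdgeCluster ω' (some o)) with hg'
  have key := sandwich_condAssocT (V := Option (Fin n)) hubW⟦S, w⟧ none (some o) T' F' hF'm h' h0' h1'
    g' (fun ω' => by
      simp only [hg']
      by_cases ha : (openGraph ω').Reachable none (some o)
      · rw [if_pos ha, if_pos ha]
      · rw [if_neg ha, if_neg ha]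
        by_cases hb : ∃ t ∈ T', (openGraph ω').Reachable (some o) t
        · rw [if_pos hb, if_pos hb]
        · rw [if_neg hb, if_neg hb])
  have hL := bhkHub_integral S w
  have hD : ∀ η : Set (Sym2 (Fin n)),
      hubLift⟦S, η⟧ ∈ {ω' : BondConfig (Option (Fin n)) |
          ∀ t ∈ T', ¬ (openGraph ω').Reachable none t} ↔
        η ∈ {ω : BondConfig (Fin n) | ∀ s ∈ S, ∀ t ∈ T, ¬ (openGraph ω).Reachable s t} := by
    intro η
    simp only [mem_setOf_eq, hT', forall_mem_image, bhkHub_reachable_none_some, not_exists,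
      not_and]
    exact ⟨fun hh s hs t ht => hh ht s hs, fun hh t ht s hs => hh s hs t ht⟩
  have hC : ∀ η : Set (Sym2 (Fin n)),
      Sym2.map some ⁻¹' openEdgeCluster (hubLift⟦S, η⟧) none = ⋃ s ∈ S, openEdgeCluster η s :=
    bhkHub_preimage_cluster_none S
  -- the sandwich function of the lift is the sandwich function of the configuration
  have hgl : ∀ η : Set (Sym2 (Fin n)), g' (hubLift⟦S, η⟧) = g η := by
    intro η
    rw [hg η]
    simp only [hg']
    by_cases hso : ∃ s ∈ S, (openGraph η).Reachable s o
    · rw [if_pos (bhkHub_reachable_none_some.2 hso), if_pos hso]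
    · rw [if_neg (fun hh => hso (bhkHub_reachable_none_some.1 hh)), if_neg hso]
      have hot : (∃ t ∈ T', (openGraph (hubLift⟦S, η⟧)).Reachable (some o) t) ↔
          ∃ t ∈ T, (openGraph η).Reachable o t := by
        simp only [hT', exists_mem_image, bhkHub_reachable_some_some hso]
      by_cases hot' : ∃ t ∈ T, (openGraph η).Reachable o t
      · rw [if_pos (hot.2 hot'), if_pos hot']
      · rw [if_neg (fun hh => hot' (hot.1 hh)), if_neg hot']
        simp only [hh', bhkHub_preimage_cluster_some hso]
  have e1 : ∫ ω' in {ω' : BondConfig (Option (Fin n)) | ∀ t ∈ T', ¬ (openGraph ω').Reachable none t},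
        F' (openEdgeCluster ω' none) ∂(prodBernoulli hubW⟦S, w⟧) =
      ∫ ω in {ω : BondConfig (Fin n) | ∀ s ∈ S, ∀ t ∈ T, ¬ (openGraph ω).Reachable s t},
        F (⋃ s ∈ S, openEdgeCluster ω s) ∂(prodBernoulli w) :=
    bhkHub_setIntegral_transfer hL hD fun η _ => by simp only [hF', hC]
  have e2 : ∫ ω' in {ω' : BondConfig (Option (Fin n)) | ∀ t ∈ T', ¬ (openGraph ω').Reachable none t},
        g' ω' ∂(prodBernoulli hubW⟦S, w⟧) =
      ∫ ω in {ω : BondConfig (Fin n) | ∀ s ∈ S, ∀ t ∈ T, ¬ (openGraph ω).Reachable s t},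
        g ω ∂(prodBernoulli w) :=
    bhkHub_setIntegral_transfer hL hD fun η _ => hgl η
  have e3 : ∫ ω' in {ω' : BondConfig (Option (Fin n)) | ∀ t ∈ T', ¬ (openGraph ω').Reachable none t},
        F' (openEdgeCluster ω' none) * g' ω' ∂(prodBernoulli hubW⟦S, w⟧) =
      ∫ ω in {ω : BondConfig (Fin n) | ∀ s ∈ S, ∀ t ∈ T, ¬ (openGraph ω).Reachable s t},
        F (⋃ s ∈ S, openEdgeCluster ω s) * g ω ∂(prodBernoulli w) :=
    bhkHub_setIntegral_transfer hL hD fun η _ => by rw [hgl η]; simp only [hF', hC]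
  have e4 : (prodBernoulli hubW⟦S, w⟧).real
        {ω' : BondConfig (Option (Fin n)) | ∀ t ∈ T', ¬ (openGraph ω').Reachable none t} =
      (prodBernoulli w).real
        {ω : BondConfig (Fin n) | ∀ s ∈ S, ∀ t ∈ T, ¬ (openGraph ω).Reachable s t} :=
    bhkHub_measureReal_transfer hL hD
  rw [e1, e2, e3, e4] at key
  exact key

end SetSource


/-! ### Event forms: bystander (sandwich) events of the observer's cluster -/

section EventForms

variable {n : ℕ}

open scoped Classical in
/-- **Positive event form.**  Let `D = {S ↮ T}`, `E` an increasing event read off `C_S` through the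
increasing `F` (`F(C_S) = 1_E`), and `Q` an event which ON `D` is the sandwich event
`{S ↔ o} ∪ ({o ↮ T} ∩ {C(o) ∈ 𝓕})` of an arbitrary family `𝓕` of vertex sets.  Then `E` and `Q` are
positively correlated given `D`: `μ(D ∩ E) μ(D ∩ Q) ≤ μ(D) μ(D ∩ E ∩ Q)`
(`sandwich_condAssoc_setSource` with `h = 1_𝓕`). [cite: VandenbergHaggstromKahn2005, Thms. 1.1–1.5 (pp. 3–8)] -/
theorem sandwich_setSource_pos (w : Sym2 (Fin n) → unitInterval) (S : Finset (Fin n)) (o : Fin n)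
    (T : Set (Fin n)) (F : Set (Sym2 (Fin n)) → ℝ) (hF : Monotone F)
    (E Q : Set (BondConfig (Fin n)))
    (hFE : ∀ ω : BondConfig (Fin n), F (⋃ s ∈ S, openEdgeCluster ω s) = E.indicator 1 ω)
    (𝓕 : Set (Set (Fin n)))
    (hQ : ∀ ω ∈ {ω : BondConfig (Fin n) | ∀ s ∈ S, ∀ t ∈ T, ¬ (openGraph ω).Reachable s t},
      ω ∈ Q ↔ ((∃ s ∈ S, (openGraph ω).Reachable s o) ∨
        ((∀ t ∈ T, ¬ (openGraph ω).Reachable o t) ∧ openCluster ω o ∈ 𝓕))) :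
    (prodBernoulli w).real
          ({ω : BondConfig (Fin n) | ∀ s ∈ S, ∀ t ∈ T, ¬ (openGraph ω).Reachable s t} ∩ E) *
        (prodBernoulli w).real
          ({ω : BondConfig (Fin n) | ∀ s ∈ S, ∀ t ∈ T, ¬ (openGraph ω).Reachable s t} ∩ Q) ≤
      (prodBernoulli w).real {ω : BondConfig (Fin n) | ∀ s ∈ S, ∀ t ∈ T, ¬ (openGraph ω).Reachable s t} *
        (prodBernoulli w).real
          ({ω : BondConfig (Fin n) | ∀ s ∈ S, ∀ t ∈ T, ¬ (openGraph ω).Reachable s t} ∩ (E ∩ Q)) := by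
  set μ := prodBernoulli w with hμ
  set D : Set (BondConfig (Fin n)) := {ω | ∀ s ∈ S, ∀ t ∈ T, ¬ (openGraph ω).Reachable s t} with hD
  have hms : ∀ s : Set (BondConfig (Fin n)), MeasurableSet s := fun _ => MeasurableSet.of_discrete
  -- the vertex set of the observer's cluster, read off the edge cluster
  have hK : ∀ ω : BondConfig (Fin n), {v | v = o ∨ ∃ e ∈ openEdgeCluster ω o, v ∈ e} = openCluster ω o :=
    fun ω => Set.ext fun v => (reachable_iff_exists_mem_openEdgeCluster ω o v).symm
  set h : Set (Sym2 (Fin n)) → ℝ := fun C => if {v | v = o ∨ ∃ e ∈ C, v ∈ e} ∈ 𝓕 then 1 else 0 with hh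
  have h0 : ∀ C, 0 ≤ h C := fun C => by simp only [hh]; split_ifs <;> norm_num
  have h1 : ∀ C, h C ≤ 1 := fun C => by simp only [hh]; split_ifs <;> norm_num
  set g : BondConfig (Fin n) → ℝ := fun ω => if ∃ s ∈ S, (openGraph ω).Reachable s o then (1 : ℝ)
      else if ∃ t ∈ T, (openGraph ω).Reachable o t then 0 else h (openEdgeCluster ω o) with hgdef
  have key := sandwich_condAssoc_setSource w S o T F hF h h0 h1 g (fun _ => rfl)
  -- on `D` the sandwich function is `1_Q`
  have hgQ : ∀ ω ∈ D, g ω = Q.indicator 1 ω := by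
    intro ω hω
    simp only [hgdef]
    by_cases ha : ∃ s ∈ S, (openGraph ω).Reachable s o
    · rw [if_pos ha, Set.indicator_of_mem ((hQ ω hω).2 (Or.inl ha)), Pi.one_apply]
    · rw [if_neg ha]
      by_cases hb : ∃ t ∈ T, (openGraph ω).Reachable o t
      · rw [if_pos hb, Set.indicator_of_notMem]
        intro hq
        rcases (hQ ω hω).1 hq with ha' | ⟨hb', -⟩
        · exact ha ha'
        · obtain ⟨t, ht, hot⟩ := hb
          exact hb' t ht hot
      · rw [if_neg hb]
        have hb' : ∀ t ∈ T, ¬ (openGraph ω).Reachable o t := fun t ht hot => hb ⟨t, ht, hot⟩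
        simp only [hh, hK]
        by_cases hc : openCluster ω o ∈ 𝓕
        · rw [if_pos hc, Set.indicator_of_mem ((hQ ω hω).2 (Or.inr ⟨hb', hc⟩)), Pi.one_apply]
        · rw [if_neg hc, Set.indicator_of_notMem]
          intro hq
          rcases (hQ ω hω).1 hq with ha' | ⟨-, hc'⟩
          · exact ha ha'
          · exact hc hc'
  -- the integrals as probabilities
  have i1 : ∫ ω in D, F (⋃ s ∈ S, openEdgeCluster ω s) ∂μ = μ.real (D ∩ E) := by
    simp_rw [hFE]
    exact (knThm2_setIntegral_indicator w D E E).1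
  have i2 : ∫ ω in D, g ω ∂μ = μ.real (D ∩ Q) := by
    rw [setIntegral_congr_fun (hms D) hgQ]
    exact (knThm2_setIntegral_indicator w D Q Q).1
  have i3 : ∫ ω in D, F (⋃ s ∈ S, openEdgeCluster ω s) * g ω ∂μ = μ.real (D ∩ (E ∩ Q)) := by
    rw [setIntegral_congr_fun (hms D) (fun ω hω => by rw [hFE, hgQ ω hω])]
    exact (knThm2_setIntegral_indicator w D E Q).2
  rw [i1, i2, i3] at key
  exact key

open scoped Classical in
/-- **Negative event form.**  Let `D = {S ↮ T}`, `E` increasing read off `C_S` (`F(C_S) = 1_E`), and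
`Q'` an event which ON `D` is the complementary sandwich event `{S ↮ o} ∩ ({o ↔ T} ∪ {C(o) ∈ 𝓕'})`
of an arbitrary family `𝓕'`.  Then `E` and `Q'` are negatively correlated given `D`:
`μ(D) μ(D ∩ E ∩ Q') ≤ μ(D ∩ E) μ(D ∩ Q')` (the positive form for `Q'ᶜ`, `𝓕'ᶜ`; BHK Thms 1.4/1.5 are
`𝓕' = ` everything). [cite: VandenbergHaggstromKahn2005, Thms. 1.4–1.5 (pp. 7–8)] -/
theorem sandwich_setSource_neg (w : Sym2 (Fin n) → unitInterval) (S : Finset (Fin n)) (o : Fin n)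
    (T : Set (Fin n)) (F : Set (Sym2 (Fin n)) → ℝ) (hF : Monotone F)
    (E Q' : Set (BondConfig (Fin n)))
    (hFE : ∀ ω : BondConfig (Fin n), F (⋃ s ∈ S, openEdgeCluster ω s) = E.indicator 1 ω)
    (𝓕' : Set (Set (Fin n)))
    (hQ' : ∀ ω ∈ {ω : BondConfig (Fin n) | ∀ s ∈ S, ∀ t ∈ T, ¬ (openGraph ω).Reachable s t},
      ω ∈ Q' ↔ ((¬ ∃ s ∈ S, (openGraph ω).Reachable s o) ∧
        ((∃ t ∈ T, (openGraph ω).Reachable o t) ∨ openCluster ω o ∈ 𝓕'))) :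
    (prodBernoulli w).real {ω : BondConfig (Fin n) | ∀ s ∈ S, ∀ t ∈ T, ¬ (openGraph ω).Reachable s t} *
        (prodBernoulli w).real
          ({ω : BondConfig (Fin n) | ∀ s ∈ S, ∀ t ∈ T, ¬ (openGraph ω).Reachable s t} ∩ (E ∩ Q')) ≤
      (prodBernoulli w).real
          ({ω : BondConfig (Fin n) | ∀ s ∈ S, ∀ t ∈ T, ¬ (openGraph ω).Reachable s t} ∩ E) *
        (prodBernoulli w).real
          ({ω : BondConfig (Fin n) | ∀ s ∈ S, ∀ t ∈ T, ¬ (openGraph ω).Reachable s t} ∩ Q') := by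
  set μ := prodBernoulli w with hμ
  set D : Set (BondConfig (Fin n)) := {ω | ∀ s ∈ S, ∀ t ∈ T, ¬ (openGraph ω).Reachable s t} with hD
  have hms : ∀ s : Set (BondConfig (Fin n)), MeasurableSet s := fun _ => MeasurableSet.of_discrete
  have key := sandwich_setSource_pos w S o T F hF E Q'ᶜ hFE 𝓕'ᶜ (fun ω hω => by
    rw [Set.mem_compl_iff, hQ' ω hω, Set.mem_compl_iff]
    by_cases ha : ∃ s ∈ S, (openGraph ω).Reachable s o
    · simp only [ha, not_true_eq_false, false_and, not_false_eq_true, true_or]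
    · have hiff : (¬ ((∃ t ∈ T, (openGraph ω).Reachable o t) ∨ openCluster ω o ∈ 𝓕')) ↔
          ((∀ t ∈ T, ¬ (openGraph ω).Reachable o t) ∧ openCluster ω o ∉ 𝓕') := by
        constructor
        · intro hno
          exact ⟨fun t ht hot => hno (Or.inl ⟨t, ht, hot⟩), fun hc => hno (Or.inr hc)⟩
        · rintro ⟨hb, hc⟩ (⟨t, ht, hot⟩ | hc')
          · exact hb t ht hot
          · exact hc hc'
      simp only [ha, not_false_eq_true, true_and, false_or]
      exact hiff)
  have e1 : μ.real (D ∩ Q'ᶜ) = μ.real D - μ.real (D ∩ Q') := by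
    have := measureReal_inter_add_sdiff (μ := μ) (s := D) (hms Q')
    rw [show D \ Q' = D ∩ Q'ᶜ from rfl] at this
    linarith
  have e2 : μ.real (D ∩ (E ∩ Q'ᶜ)) = μ.real (D ∩ E) - μ.real (D ∩ (E ∩ Q')) := by
    have := measureReal_inter_add_sdiff (μ := μ) (s := D ∩ E) (hms Q')
    rw [show (D ∩ E) \ Q' = D ∩ (E ∩ Q'ᶜ) from (Set.inter_assoc D E Q'ᶜ),
      Set.inter_assoc] at this
    linarith
  change μ.real (D ∩ E) * μ.real (D ∩ Q'ᶜ) ≤ μ.real D * μ.real (D ∩ (E ∩ Q'ᶜ)) at key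
  rw [e1, e2] at key
  nlinarith [key]

end EventForms


/-! ### Registered stub form -/

/-- **Registered stub `stub_sandwichSetSourcePos_v1362`** (= `sandwich_setSource_pos`): the positive
event form of Corollary H for a source SET `S`, a conditioning set `T` and an arbitrary sandwich event
of the observer's cluster — the tool behind the bystander version of Kozma–Nitzan's Theorem 2
(GOOD for three relays in the good case, TTRL variant V1362 of `stub_goodStep`).
[cite: VandenbergHaggstromKahn2005, Thms. 1.1–1.5 (pp. 3–8)] -/
theorem stub_sandwichSetSourcePos_v1362 : ∀ (n : ℕ) (w : Sym2 (Fin n) → unitInterval) (S : Finset (Fin n)) (o : Fin n) (T : Set (Fin n)) (F : Set (Sym2 (Fin n)) → ℝ), Monotone F → ∀ (E Q : Set (Set (Sym2 (Fin n)))), (∀ ω : Set (Sym2 (Fin n)), F (⋃ s ∈ S, Literature.Probability.Percolation.openEdgeCluster ω s) = E.indicator (1 : Set (Sym2 (Fin n)) → ℝ) ω) → ∀ (𝓕 : Set (Set (Fin n))), (∀ ω ∈ {ω : Set (Sym2 (Fin n)) | ∀ s ∈ S, ∀ t ∈ T, ¬ (Literature.Probability.Percolation.openGraph ω).Reachable s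 t}, ω ∈ Q ↔ ((∃ s ∈ S, (Literature.Probability.Percolation.openGraph ω).Reachable s o) ∨ ((∀ t ∈ T, ¬ (Literature.Probability.Percolation.openGraph ω).Reachable o t) ∧ Literature.Probability.Percolation.openCluster ω o ∈ 𝓕))) → (Literature.Probability.LatticeModels.prodBernoulli w).real ({ω : Set (Sym2 (Fin n)) | ∀ s ∈ S, ∀ t ∈ T, ¬ (Literature.Probability.Percolation.openGraph ω).Reachable s t} ∩ E) * (Literature.Probability.LatticeModels.prodBernoulli w).real ({ω : Set (Sym2 (Fin n)) | ∀ s ∈ S, ∀ t ∈ T, ¬ (Literature.Probability.Percolation.openGraph ω).Reachable s t} ∩ Q) ≤ (Literature.Probability.LatticeModels.prodBernoulli w).real {ω : Set (Sym2 (Fin n)) | ∀ s ∈ S, ∀ t ∈ T, ¬ (Literature.Probability.Percolation.openGraph ω).Reachable s t} * (Literature.Probability.LatticeModels.prodBernoulli w).real ({ω : Set (Sym2 (Fin n)) | ∀ s ∈ S, ∀ t ∈ T, ¬ (Literature.Probability.Percolation.openGraph ω).Reachable s t} ∩ (E ∩ Q)) :=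
  fun _ w S o T F hF E Q hFE 𝓕 hQ => sandwich_setSource_pos w S o T F hF E Q hFE 𝓕 hQ

end Summit.CriticalPhenomena.PercolationContinuityZ3.Theorems
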